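import Literature.NumberTheory.EllipticCurves.CasselsTateParity
import HarnessLib

/-!
# Corank parity for a dual pair of `p`-primary groups

Stub `stub_corankParity_of_finite` (F1b) of the line `toric-node-vacuity-cassels` of the crux
`PencilSelmerDictionary` (stmt-Parity-11584, route IsogenyRedei). Pure algebra, no structure theorem:
for `p`-primary `A`, `A'` with finite `p`-torsion, a dual pair `f : A → A'`, `g : A' → A`
(`g ∘ f = p`, `f ∘ g = p`) and adjoint alternating `ℚ/ℤ`-valued pairings with `p^∞`-divisible left
kernels, GRANTED the finite-level parity `hfin`, `zpCorank A p ≡ log_p (#ker g · #ker f) (mod 2)`.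
Template: `Literature.NumberTheory.EllipticCurves.CasselsTateParity`. The chains `A[p] ∩ p^k A`,
`A'[p] ∩ p^k A'` are constant from a common `k` on; `C = p^k A`, `C' = p^k A'` are `p`-divisible with
`f(C) = C'`, `g(C') = C`; `T = A/C`, `T' = A'/C'` are finite with induced nondegenerate alternating
pairings and adjoint `f̄`, `ḡ` (so `hfin` applies); and `#ker f = #(ker f ∩ C) · #ker f̄`,
`#ker g = #(ker g ∩ C') · #ker ḡ`, `#(A[p] ∩ C) = #(ker g ∩ C') · #(ker f ∩ C)`,
`p ^ zpCorank A p = #(A[p] ∩ C)` (`zpCorank_eq_add_of_exact` along `0 → C → A → T → 0`).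
-/
noncomputable section

open scoped Classical
open scoped AddSubgroup
open Literature.NumberTheory.EllipticCurves

namespace Summit.Parity.BatemanHorn.Theorems.PencilSelmerDictionary

universe v

section OneGroup

variable {A : Type*} [AddCommGroup A] {Q : Type*} [AddCommGroup Q] (p : ℕ)

/-- For a `p`-primary `A` whose chain `A[p] ∩ p^{k'} A` is constant for `k' ≥ k`, the subgroup
`C = p^k A` is `p`-divisible: every `c ∈ C` is `p • c'` with `c' ∈ C`
(`exists_nsmul_eq_of_stable`). -/
theorem exists_nsmul_eq_of_stable_of_primary (hA : ∀ a : A, ∃ n : ℕ, p ^ n • a = 0) {k : ℕ}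
    (hst : ∀ k', k ≤ k' → A[(p : ℤ)] ⊓ (nsmulAddMonoidHom (α := A) (p ^ k')).range =
      A[(p : ℤ)] ⊓ (nsmulAddMonoidHom (α := A) (p ^ k)).range) :
    ∀ c ∈ (nsmulAddMonoidHom (α := A) (p ^ k)).range,
      ∃ c' ∈ (nsmulAddMonoidHom (α := A) (p ^ k)).range, p • c' = c := fun c hc ↦ by
  obtain ⟨n, hn⟩ := hA c
  exact exists_nsmul_eq_of_stable p hst n c hc hn

/-- For a `p`-primary `A` with finite `A[p]` whose chain `A[p] ∩ p^{k'} A` is constant for `k' ≥ k`,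
the quotient `T = A / p^k A` is finite: `T[p]` is the image of `A[p]` (as `p^k A` is `p`-divisible)
and `p^k T = 0`, so `T = T[p^k]` is finite (`finite_torsionBy_pow`). -/
theorem finite_quotient_of_stable (hA : ∀ a : A, ∃ n : ℕ, p ^ n • a = 0) [Finite A[(p : ℤ)]]
    {k : ℕ} (hst : ∀ k', k ≤ k' → A[(p : ℤ)] ⊓ (nsmulAddMonoidHom (α := A) (p ^ k')).range =
      A[(p : ℤ)] ⊓ (nsmulAddMonoidHom (α := A) (p ^ k)).range) :
    Finite (A ⧸ (nsmulAddMonoidHom (α := A) (p ^ k)).range) := by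
  have hdiv := exists_nsmul_eq_of_stable_of_primary p hA hst
  set C : AddSubgroup A := (nsmulAddMonoidHom (α := A) (p ^ k)).range with hC
  haveI : Finite (A ⧸ C)[(p : ℤ)] := by
    refine Finite.of_surjective (fun x : A[(p : ℤ)] ↦ (⟨QuotientAddGroup.mk (x : A), ?_⟩ :
      (A ⧸ C)[(p : ℤ)])) ?_
    · rw [AddSubgroup.torsionBy.nsmul_iff, ← QuotientAddGroup.mk_nsmul,
        AddSubgroup.torsionBy.nsmul_iff.mp x.2, QuotientAddGroup.mk_zero]
    · rintro ⟨z, hz⟩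
      induction z using QuotientAddGroup.induction_on with
      | H a =>
        rw [AddSubgroup.torsionBy.nsmul_iff, ← QuotientAddGroup.mk_nsmul,
          QuotientAddGroup.eq_zero_iff] at hz
        obtain ⟨c, hc, hca⟩ := hdiv _ hz
        refine ⟨⟨a - c, ?_⟩, Subtype.ext ?_⟩
        · rw [AddSubgroup.torsionBy.nsmul_iff, smul_sub, hca, sub_self]
        · change (QuotientAddGroup.mk (a - c) : A ⧸ C) = QuotientAddGroup.mk a
          rw [QuotientAddGroup.mk_sub, (QuotientAddGroup.eq_zero_iff c).mpr hc, sub_zero]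
  haveI := finite_torsionBy_pow (A ⧸ C) p k
  refine Finite.of_injective (fun z : A ⧸ C ↦ (⟨z, ?_⟩ : (A ⧸ C)[((p ^ k : ℕ) : ℤ)]))
    (fun z w h ↦ congrArg Subtype.val h)
  induction z using QuotientAddGroup.induction_on with
  | H a =>
    rw [AddSubgroup.torsionBy.nsmul_iff, ← QuotientAddGroup.mk_nsmul, QuotientAddGroup.eq_zero_iff]
    exact ⟨a, rfl⟩

/-- For a `p`-primary `A` whose chain `A[p] ∩ p^{k'} A` is constant for `k' ≥ k`, an alternating
bi-additive pairing `B` on `A` whose left kernel is `p^∞`-divisible descends to `T = A / p^k A`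
(`B` vanishes on `C × A` and `A × C` for the `p`-divisible `C = p^k A`, `A` being torsion), and the
induced pairing is alternating with trivial left kernel (the kernel of `B` lies in `p^k A = C`). -/
theorem exists_quotient_pairing_of_stable (hA : ∀ a : A, ∃ n : ℕ, p ^ n • a = 0) {k : ℕ}
    (hst : ∀ k', k ≤ k' → A[(p : ℤ)] ⊓ (nsmulAddMonoidHom (α := A) (p ^ k')).range =
      A[(p : ℤ)] ⊓ (nsmulAddMonoidHom (α := A) (p ^ k)).range)
    (B : A →+ A →+ Q) (halt : ∀ a, B a a = 0)
    (hker : ∀ a, (∀ b, B a b = 0) → ∀ k : ℕ, a ∈ (nsmulAddMonoidHom (α := A) (p ^ k)).range) :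
    ∃ B' : A ⧸ (nsmulAddMonoidHom (α := A) (p ^ k)).range →+
        A ⧸ (nsmulAddMonoidHom (α := A) (p ^ k)).range →+ Q,
      (∀ a b, B' (QuotientAddGroup.mk a) (QuotientAddGroup.mk b) = B a b) ∧ (∀ z, B' z z = 0) ∧
        ∀ z, (∀ w, B' z w = 0) → z = 0 := by
  have hdiv := exists_nsmul_eq_of_stable_of_primary p hA hst
  have hkerk : ∀ a, (∀ b, B a b = 0) → a ∈ (nsmulAddMonoidHom (α := A) (p ^ k)).range :=
    fun a h ↦ hker a h k
  set C : AddSubgroup A := (nsmulAddMonoidHom (α := A) (p ^ k)).range with hC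
  -- `C` is `p^j`-divisible
  have hdiv' : ∀ (j : ℕ), ∀ c ∈ C, ∃ c' ∈ C, p ^ j • c' = c := by
    intro j
    induction j with
    | zero => exact fun c hc ↦ ⟨c, hc, by rw [pow_zero, one_smul]⟩
    | succ j ih =>
      intro c hc
      obtain ⟨c₁, hc₁, rfl⟩ := ih c hc
      obtain ⟨c₂, hc₂, rfl⟩ := hdiv c₁ hc₁
      exact ⟨c₂, hc₂, by rw [pow_succ, ← smul_smul]⟩
  -- `B` vanishes on `C × A` and `A × C`
  have hC₁ : ∀ c ∈ C, ∀ b, B c b = 0 := by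
    intro c hc b
    obtain ⟨n, hn⟩ := hA b
    obtain ⟨c', -, rfl⟩ := hdiv' n c hc
    rw [map_nsmul, AddMonoidHom.nsmul_apply, ← map_nsmul, hn, map_zero]
  have hC₂ : ∀ a, ∀ c ∈ C, B a c = 0 := fun a c hc ↦ by
    rw [Literature.GroupTheory.FiniteAbelian.eq_neg_of_alternating B halt, hC₁ c hc a, neg_zero]
  obtain ⟨B', hB'⟩ := exists_quotient_pairing C B hC₁ hC₂
  refine ⟨B', hB', fun z ↦ ?_, fun z hz ↦ ?_⟩
  · induction z using QuotientAddGroup.induction_on with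
    | H a => rw [hB', halt]
  · induction z using QuotientAddGroup.induction_on with
    | H a =>
      rw [QuotientAddGroup.eq_zero_iff]
      exact hkerk a (fun b ↦ by rw [← hB', hz])

/-- A finite additive group killed by the prime `p` (an `𝔽_p`-vector space) has order a power of
`p`. -/
theorem exists_natCard_eq_pow_of_nsmul_eq_zero [Fact p.Prime] {V : Type*} [AddCommGroup V]
    [Finite V] (h : ∀ v : V, p • v = 0) : ∃ n : ℕ, Nat.card V = p ^ n := by
  letI : Module (ZMod p) V := AddCommGroup.zmodModule h
  exact ⟨_, (Literature.GroupTheory.FiniteAbelian.pow_finrank_eq_natCard p V).symm⟩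

/-- **The corank of a stable `p`-primary group.** For a `p`-primary `A` with finite `A[p]` whose
chain `A[p] ∩ p^{k'} A` is constant for `k' ≥ k`, `p ^ zpCorank A p = #(A[p] ∩ p^k A)`: along
`0 → C → A → A/C → 0` with `C = p^k A` `p`-divisible and `A/C` finite, the corank formula is additive
(`zpCorank_eq_add_of_exact`: `zpCorank A p = dim C[p] + zpCorank (A/C) p`), and the corank formula of
the finite group `A/C` vanishes (`#T[p] = #(T/pT)`). -/
theorem pow_zpCorank_eq_natCard_of_stable [hp : Fact p.Prime]
    (hA : ∀ a : A, ∃ n : ℕ, p ^ n • a = 0) [Finite A[(p : ℤ)]] {k : ℕ}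
    (hst : ∀ k', k ≤ k' → A[(p : ℤ)] ⊓ (nsmulAddMonoidHom (α := A) (p ^ k')).range =
      A[(p : ℤ)] ⊓ (nsmulAddMonoidHom (α := A) (p ^ k)).range) :
    p ^ zpCorank A p = Nat.card ↥(A[(p : ℤ)] ⊓ (nsmulAddMonoidHom (α := A) (p ^ k)).range) := by
  have hdiv₀ := exists_nsmul_eq_of_stable_of_primary p hA hst
  haveI hTfin := finite_quotient_of_stable p hA hst
  set C : AddSubgroup A := (nsmulAddMonoidHom (α := A) (p ^ k)).range with hC
  have hdiv : ∀ d : C, ∃ d' : C, p • d' = d := fun d ↦ by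
    obtain ⟨d', hd', h⟩ := hdiv₀ d d.2
    exact ⟨⟨d', hd'⟩, Subtype.ext h⟩
  letI : Module (ZMod p) (↥C)[(p : ℤ)] := AddSubgroup.torsionBy.zmodModule
  haveI : Finite (↥C)[(p : ℤ)] :=
    Finite.of_injective (torsionByMap C.subtype p) (torsionByMap_injective Subtype.val_injective p)
  have hr : Nat.card (↥C)[(p : ℤ)] = p ^ Module.finrank (ZMod p) (↥C)[(p : ℤ)] :=
    (Literature.GroupTheory.FiniteAbelian.pow_finrank_eq_natCard p _).symm
  have hT : ∀ q : A ⧸ C, ∃ m : ℕ, p ^ m • q = 0 := fun q ↦ by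
    induction q using QuotientAddGroup.induction_on with
    | H a =>
      obtain ⟨m, hm⟩ := hA a
      exact ⟨m, by rw [← QuotientAddGroup.mk_nsmul, hm, QuotientAddGroup.mk_zero]⟩
  have hcor : zpCorank A p = Module.finrank (ZMod p) (↥C)[(p : ℤ)] + zpCorank (A ⧸ C) p :=
    zpCorank_eq_add_of_exact (i := C.subtype) (f := QuotientAddGroup.mk' C) Subtype.val_injective
      (QuotientAddGroup.mk'_surjective C)
      (fun a ha ↦ ⟨⟨a, (QuotientAddGroup.eq_zero_iff a).mp ha⟩, rfl⟩)
      (fun d ↦ (QuotientAddGroup.eq_zero_iff _).mpr d.2) hdiv hr hT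
  -- the corank formula of the finite group `A / C` vanishes
  have h0 : zpCorank (A ⧸ C) p = 0 := by
    letI : Module (ZMod p) (A ⧸ C)[(p : ℤ)] := AddSubgroup.torsionBy.zmodModule
    haveI : Finite (ModN (A ⧸ C) p) := Literature.GroupTheory.FiniteAbelian.finite_modN p
    have h : Module.finrank (ZMod p) (A ⧸ C)[(p : ℤ)] =
        Module.finrank (ZMod p) (ModN (A ⧸ C) p) := by
      apply Nat.pow_right_injective hp.out.two_le
      simp only [Literature.GroupTheory.FiniteAbelian.pow_finrank_eq_natCard,
        Literature.GroupTheory.FiniteAbelian.natCard_torsionBy_eq_natCard_modN]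
    unfold zpCorank
    rw [h, Nat.sub_self]
  -- `C[p] ≅ A[p] ∩ C`
  have heq : (↥C)[(p : ℤ)] = (A[(p : ℤ)] ⊓ C).addSubgroupOf C := by
    ext x
    rw [AddSubgroup.mem_addSubgroupOf, AddSubgroup.mem_inf, AddSubgroup.torsionBy.nsmul_iff,
      AddSubgroup.torsionBy.nsmul_iff, ← Subtype.coe_inj, AddSubgroupClass.coe_nsmul,
      ZeroMemClass.coe_zero]
    exact (and_iff_left x.2).symm
  rw [hcor, h0, add_zero, ← hr, heq]
  exact Nat.card_congr (AddSubgroup.addSubgroupOfEquivOfLe inf_le_right).toEquiv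

end OneGroup

section TwoGroups

variable {A : Type*} [AddCommGroup A] {A' : Type*} [AddCommGroup A'] (p : ℕ)

/-- **Counting a kernel through a quotient.** If `f : A → A'`, `C ≤ A`, `C' ≤ A'` with `C' ⊆ f(C)`,
and `f̄ : A/C → A'/C'` is induced by `f`, then `#ker f = #(ker f ∩ C) · #ker f̄`: the map
`ker f → ker f̄`, `a ↦ ā`, is onto (`f a ∈ C' = f(C)` gives `c ∈ C` with `a - c ∈ ker f`) with kernel
`ker f ∩ C`. -/
theorem natCard_ker_eq_mul_natCard_ker_quotient (f : A →+ A') (C : AddSubgroup A)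
    (C' : AddSubgroup A') (hC'C : ∀ c' ∈ C', ∃ c ∈ C, f c = c') (fb : A ⧸ C →+ A' ⧸ C')
    (hfb : ∀ a, fb (QuotientAddGroup.mk a) = QuotientAddGroup.mk (f a)) :
    Nat.card f.ker = Nat.card ↥(f.ker ⊓ C) * Nat.card fb.ker := by
  -- the map `ker f → ker f̄`
  let φ : f.ker →+ fb.ker := ((QuotientAddGroup.mk' C).comp f.ker.subtype).codRestrict fb.ker
    (fun x ↦ by
      rw [AddMonoidHom.mem_ker, AddMonoidHom.comp_apply, AddSubgroup.coe_subtype,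
        QuotientAddGroup.mk'_apply, hfb, (AddMonoidHom.mem_ker).mp x.2, QuotientAddGroup.mk_zero])
  have hφ : ∀ x : f.ker, ((φ x : fb.ker) : A ⧸ C) = QuotientAddGroup.mk (x : A) := fun _ ↦ rfl
  have hφs : Function.Surjective φ := by
    rintro ⟨z, hz⟩
    induction z using QuotientAddGroup.induction_on with
    | H a =>
      rw [AddMonoidHom.mem_ker, hfb, QuotientAddGroup.eq_zero_iff] at hz
      obtain ⟨c, hc, hca⟩ := hC'C _ hz
      refine ⟨⟨a - c, ?_⟩, Subtype.ext ?_⟩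
      · rw [AddMonoidHom.mem_ker, map_sub, hca, sub_self]
      · rw [hφ]
        change (QuotientAddGroup.mk (a - c) : A ⧸ C) = QuotientAddGroup.mk a
        rw [QuotientAddGroup.mk_sub, (QuotientAddGroup.eq_zero_iff c).mpr hc, sub_zero]
  have hφk : φ.ker = (f.ker ⊓ C).addSubgroupOf f.ker := by
    ext x
    rw [AddMonoidHom.mem_ker, AddSubgroup.mem_addSubgroupOf, AddSubgroup.mem_inf, ← Subtype.coe_inj,
      hφ, ZeroMemClass.coe_zero, QuotientAddGroup.eq_zero_iff]
    exact (and_iff_right x.2).symm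
  rw [AddSubgroup.card_eq_card_quotient_mul_card_addSubgroup φ.ker,
    Nat.card_congr (QuotientAddGroup.quotientKerEquivOfSurjective φ hφs).toEquiv, hφk,
    Nat.card_congr (AddSubgroup.addSubgroupOfEquivOfLe inf_le_left).toEquiv, mul_comm]

/-- **Counting `C[p]` through a dual pair.** If `g ∘ f = p` on `A`, `f(C) ⊆ C'` and `C' ⊆ f(C)`,
then `#(A[p] ∩ C) = #(ker g ∩ C') · #(ker f ∩ C)`: `f` maps `A[p] ∩ C` onto `ker g ∩ C'`
(`x = f c` with `c ∈ C` has `p c = g x = 0`) with kernel `ker f ∩ C` (`ker f ⊆ A[p]`). -/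
theorem natCard_torsionBy_inf_eq_mul (f : A →+ A') (g : A' →+ A) (hgf : ∀ a, g (f a) = p • a)
    (C : AddSubgroup A) (C' : AddSubgroup A') (hCC' : ∀ c ∈ C, f c ∈ C')
    (hC'C : ∀ c' ∈ C', ∃ c ∈ C, f c = c') :
    Nat.card ↥(A[(p : ℤ)] ⊓ C) = Nat.card ↥(g.ker ⊓ C') * Nat.card ↥(f.ker ⊓ C) := by
  -- `f` restricted: `A[p] ∩ C → ker g ∩ C'`
  let ψ : ↥(A[(p : ℤ)] ⊓ C) →+ ↥(g.ker ⊓ C') := (f.comp (A[(p : ℤ)] ⊓ C).subtype).codRestrict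
    (g.ker ⊓ C') (fun x ↦ by
      obtain ⟨hxp, hxC⟩ := AddSubgroup.mem_inf.mp x.2
      refine AddSubgroup.mem_inf.mpr ⟨?_, hCC' _ hxC⟩
      rw [AddMonoidHom.mem_ker, AddMonoidHom.comp_apply, AddSubgroup.coe_subtype, hgf]
      exact AddSubgroup.torsionBy.nsmul_iff.mp hxp)
  have hψ : ∀ x, ((ψ x : ↥(g.ker ⊓ C')) : A') = f x := fun _ ↦ rfl
  have hψs : Function.Surjective ψ := by
    rintro ⟨y, hy⟩
    obtain ⟨hyg, hyC'⟩ := AddSubgroup.mem_inf.mp hy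
    obtain ⟨c, hc, rfl⟩ := hC'C y hyC'
    refine ⟨⟨c, AddSubgroup.mem_inf.mpr ⟨?_, hc⟩⟩, Subtype.ext (hψ _)⟩
    rw [AddSubgroup.torsionBy.nsmul_iff, ← hgf]
    exact hyg
  have hle : f.ker ⊓ C ≤ A[(p : ℤ)] ⊓ C := by
    refine inf_le_inf_right C fun a ha ↦ ?_
    rw [AddSubgroup.torsionBy.nsmul_iff, ← hgf, (AddMonoidHom.mem_ker).mp ha, map_zero]
  have hψk : ψ.ker = (f.ker ⊓ C).addSubgroupOf (A[(p : ℤ)] ⊓ C) := by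
    ext x
    rw [AddMonoidHom.mem_ker, AddSubgroup.mem_addSubgroupOf, AddSubgroup.mem_inf, ← Subtype.coe_inj,
      hψ, ZeroMemClass.coe_zero, AddMonoidHom.mem_ker]
    exact (and_iff_left (AddSubgroup.mem_inf.mp x.2).2).symm
  rw [AddSubgroup.card_eq_card_quotient_mul_card_addSubgroup ψ.ker,
    Nat.card_congr (QuotientAddGroup.quotientKerEquivOfSurjective ψ hψs).toEquiv, hψk,
    Nat.card_congr (AddSubgroup.addSubgroupOfEquivOfLe hle).toEquiv]

end TwoGroups

/-- **Stub F1b — corank parity for a dual pair, from the finite level (pure algebra).** `A`, `A'` are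
`p`-primary abelian groups with finite `p`-torsion; `f : A → A'`, `g : A' → A` satisfy `g ∘ f = p`,
`f ∘ g = p`; `B`, `B'` are alternating bi-additive `ℚ/ℤ`-valued pairings on `A`, `A'` whose left
kernels consist of `p^∞`-divisible elements (`hker`, `hker'`), and `f`, `g` are adjoint. Then, GRANTED
the finite-level statement (hypothesis `hfin`: for finite `p`-groups with nondegenerate alternating
pairings and adjoint maps, `log_p #ker f ≡ log_p #ker g (mod 2)`), the `ℤ_p`-corank of `A`
(`zpCorank A p = dim A[p] − dim A/pA`) has the parity of `log_p (#ker g · #ker f)`.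
Proof: the chains `A[p] ∩ p^k A`, `A'[p] ∩ p^k A'` stabilise from a common `k` on; `C = p^k A`,
`C' = p^k A'` are `p`-divisible with `f(C) = C'`, `g(C') = C`; `T = A/C`, `T' = A'/C'` are finite and
inherit nondegenerate alternating pairings for which the induced `f̄`, `ḡ` are adjoint, so `hfin` gives
`log_p #ker f̄ ≡ log_p #ker ḡ`; and `#ker f = #(ker f ∩ C) · #ker f̄`, `#ker g = #(ker g ∩ C') · #ker ḡ`,
`#(A[p] ∩ C) = #(ker g ∩ C') · #(ker f ∩ C)`, `p ^ zpCorank A p = #(A[p] ∩ C)`, the kernels of `f̄`,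
`ḡ` being killed by `p`. Folklore (the algebra behind Dokchitser–Dokchitser 2011 Thm 30 and Milne,
*ADT* I.7.3). -/
theorem stub_corankParity_of_finite (p : ℕ) [Fact p.Prime] {A A' : Type v} [AddCommGroup A]
    [AddCommGroup A']
    (hfin : ∀ {T T' : Type v} [AddCommGroup T] [AddCommGroup T'] [Finite T] [Finite T'],
      (∀ t : T, ∃ n : ℕ, p ^ n • t = 0) → (∀ t' : T', ∃ n : ℕ, p ^ n • t' = 0) →
        ∀ (f : T →+ T') (g : T' →+ T) (B : T →+ T →+ AddCircle (1 : ℚ))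
          (B' : T' →+ T' →+ AddCircle (1 : ℚ)),
          (∀ t, B t t = 0) → (∀ t', B' t' t' = 0) →
            (∀ x, (∀ y, B x y = 0) → x = 0) → (∀ x', (∀ y', B' x' y' = 0) → x' = 0) →
              (∀ t t', B' (f t) t' = B t (g t')) →
                Nat.log p (Nat.card f.ker) % 2 = Nat.log p (Nat.card g.ker) % 2)
    (hA : ∀ a : A, ∃ n : ℕ, p ^ n • a = 0) (hA' : ∀ a' : A', ∃ n : ℕ, p ^ n • a' = 0)
    [Finite (AddSubgroup.torsionBy A (p : ℤ))] [Finite (AddSubgroup.torsionBy A' (p : ℤ))]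
    (f : A →+ A') (g : A' →+ A) (hgf : ∀ a, g (f a) = p • a) (hfg : ∀ a', f (g a') = p • a')
    (B : A →+ A →+ AddCircle (1 : ℚ)) (B' : A' →+ A' →+ AddCircle (1 : ℚ))
    (halt : ∀ a, B a a = 0) (halt' : ∀ a', B' a' a' = 0)
    (hker : ∀ a, (∀ b, B a b = 0) → ∀ k : ℕ, a ∈ (nsmulAddMonoidHom (α := A) (p ^ k)).range)
    (hker' : ∀ a', (∀ b', B' a' b' = 0) → ∀ k : ℕ, a' ∈ (nsmulAddMonoidHom (α := A') (p ^ k)).range)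
    (hadj : ∀ a a', B' (f a) a' = B a (g a')) :
    zpCorank A p % 2 = Nat.log p (Nat.card g.ker * Nat.card f.ker) % 2 := by
  have hp : p.Prime := Fact.out
  -- (1) a common stability index `k` for the chains `A[p] ∩ p^k A`, `A'[p] ∩ p^k A'`
  obtain ⟨k, hst, hst'⟩ : ∃ k : ℕ,
      (∀ k', k ≤ k' → A[(p : ℤ)] ⊓ (nsmulAddMonoidHom (α := A) (p ^ k')).range =
        A[(p : ℤ)] ⊓ (nsmulAddMonoidHom (α := A) (p ^ k)).range) ∧
      (∀ k', k ≤ k' → A'[(p : ℤ)] ⊓ (nsmulAddMonoidHom (α := A') (p ^ k')).range =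
        A'[(p : ℤ)] ⊓ (nsmulAddMonoidHom (α := A') (p ^ k)).range) := by
    obtain ⟨k₁, hk₁⟩ := exists_torsionBy_inf_range_stable (A := A) p
    obtain ⟨k₂, hk₂⟩ := exists_torsionBy_inf_range_stable (A := A') p
    exact ⟨max k₁ k₂,
      fun k' hk' ↦ (hk₁ k' ((le_max_left _ _).trans hk')).trans (hk₁ _ (le_max_left _ _)).symm,
      fun k' hk' ↦ (hk₂ k' ((le_max_right _ _).trans hk')).trans (hk₂ _ (le_max_right _ _)).symm⟩
  set C : AddSubgroup A := (nsmulAddMonoidHom (α := A) (p ^ k)).range with hC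
  set C' : AddSubgroup A' := (nsmulAddMonoidHom (α := A') (p ^ k)).range with hC'
  -- `C = p^k A`, `C' = p^k A'` are `p`-divisible with finite `p`-primary quotients carrying the
  -- induced nondegenerate alternating pairings, and `p ^ zpCorank A p = #(A[p] ∩ C)`
  have hdiv : ∀ c ∈ C, ∃ c₁ ∈ C, p • c₁ = c := exists_nsmul_eq_of_stable_of_primary p hA hst
  have hdiv' : ∀ c' ∈ C', ∃ c₁ ∈ C', p • c₁ = c' :=
    exists_nsmul_eq_of_stable_of_primary p hA' hst'
  haveI hTfin : Finite (A ⧸ C) := finite_quotient_of_stable p hA hst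
  haveI hT'fin : Finite (A' ⧸ C') := finite_quotient_of_stable p hA' hst'
  obtain ⟨Bb, hBb, hBbalt, hBbnd⟩ : ∃ Bb : A ⧸ C →+ A ⧸ C →+ AddCircle (1 : ℚ),
      (∀ a b, Bb (QuotientAddGroup.mk a) (QuotientAddGroup.mk b) = B a b) ∧ (∀ z, Bb z z = 0) ∧
        ∀ z, (∀ w, Bb z w = 0) → z = 0 :=
    exists_quotient_pairing_of_stable p hA hst B halt hker
  obtain ⟨Bb', hBb', hBb'alt, hBb'nd⟩ : ∃ Bb' : A' ⧸ C' →+ A' ⧸ C' →+ AddCircle (1 : ℚ),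
      (∀ a' b', Bb' (QuotientAddGroup.mk a') (QuotientAddGroup.mk b') = B' a' b') ∧
        (∀ z, Bb' z z = 0) ∧ ∀ z, (∀ w, Bb' z w = 0) → z = 0 :=
    exists_quotient_pairing_of_stable p hA' hst' B' halt' hker'
  have h8 : p ^ zpCorank A p = Nat.card ↥(A[(p : ℤ)] ⊓ C) :=
    pow_zpCorank_eq_natCard_of_stable p hA hst
  -- (2) `f(C) = C'`, `g(C') = C`
  have hfC : ∀ c ∈ C, f c ∈ C' := by
    rintro _ ⟨a, rfl⟩
    exact ⟨f a, by rw [nsmulAddMonoidHom_apply, nsmulAddMonoidHom_apply, map_nsmul]⟩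
  have hgC' : ∀ c' ∈ C', g c' ∈ C := by
    rintro _ ⟨a', rfl⟩
    exact ⟨g a', by rw [nsmulAddMonoidHom_apply, nsmulAddMonoidHom_apply, map_nsmul]⟩
  have hC'f : ∀ c' ∈ C', ∃ c ∈ C, f c = c' := fun c' hc' ↦ by
    obtain ⟨c'', hc'', rfl⟩ := hdiv' c' hc'
    exact ⟨g c'', hgC' c'' hc'', hfg c''⟩
  have hCg : ∀ c ∈ C, ∃ c' ∈ C', g c' = c := fun c hc ↦ by
    obtain ⟨c₁, hc₁, rfl⟩ := hdiv c hc
    exact ⟨f c₁, hfC c₁ hc₁, hgf c₁⟩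
  -- (3) the finite `p`-primary quotients `T = A/C`, `T' = A'/C'` and the induced maps `f̄`, `ḡ`
  have hT : ∀ t : A ⧸ C, ∃ n : ℕ, p ^ n • t = 0 := fun t ↦ by
    induction t using QuotientAddGroup.induction_on with
    | H a =>
      obtain ⟨n, hn⟩ := hA a
      exact ⟨n, by rw [← QuotientAddGroup.mk_nsmul, hn, QuotientAddGroup.mk_zero]⟩
  have hT' : ∀ t' : A' ⧸ C', ∃ n : ℕ, p ^ n • t' = 0 := fun t' ↦ by
    induction t' using QuotientAddGroup.induction_on with
    | H a' =>
      obtain ⟨n, hn⟩ := hA' a'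
      exact ⟨n, by rw [← QuotientAddGroup.mk_nsmul, hn, QuotientAddGroup.mk_zero]⟩
  obtain ⟨fb, hfb⟩ : ∃ fb : A ⧸ C →+ A' ⧸ C',
      ∀ a, fb (QuotientAddGroup.mk a) = QuotientAddGroup.mk (f a) :=
    ⟨QuotientAddGroup.map C C' f fun c hc ↦ hfC c hc, fun _ ↦ rfl⟩
  obtain ⟨gb, hgb⟩ : ∃ gb : A' ⧸ C' →+ A ⧸ C,
      ∀ a', gb (QuotientAddGroup.mk a') = QuotientAddGroup.mk (g a') :=
    ⟨QuotientAddGroup.map C' C g fun c' hc' ↦ hgC' c' hc', fun _ ↦ rfl⟩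
  -- (4) adjointness descends
  have hadjb : ∀ t t', Bb' (fb t) t' = Bb t (gb t') := fun t t' ↦ by
    induction t using QuotientAddGroup.induction_on with
    | H a =>
      induction t' using QuotientAddGroup.induction_on with
      | H a' => rw [hfb, hgb, hBb, hBb', hadj]
  -- (5) the finite-level parity `log_p #ker f̄ ≡ log_p #ker ḡ (mod 2)`
  have hpar := @hfin (A ⧸ C) (A' ⧸ C') _ _ hTfin hT'fin hT hT' fb gb Bb Bb' hBbalt hBb'alt hBbnd
    hBb'nd hadjb
  -- the kernels of `f̄`, `ḡ` are killed by `p` (`g ∘ f = p`, `g(C') ⊆ C`), hence of `p`-power order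
  obtain ⟨i, hi⟩ : ∃ i : ℕ, Nat.card fb.ker = p ^ i := by
    refine exists_natCard_eq_pow_of_nsmul_eq_zero p ?_
    rintro ⟨z, hz⟩
    apply Subtype.ext
    induction z using QuotientAddGroup.induction_on with
    | H a =>
      rw [AddMonoidHom.mem_ker, hfb, QuotientAddGroup.eq_zero_iff] at hz
      rw [AddSubgroupClass.coe_nsmul, ZeroMemClass.coe_zero]
      change p • (QuotientAddGroup.mk a : A ⧸ C) = 0
      rw [← QuotientAddGroup.mk_nsmul, QuotientAddGroup.eq_zero_iff, ← hgf a]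
      exact hgC' _ hz
  obtain ⟨j, hj⟩ : ∃ j : ℕ, Nat.card gb.ker = p ^ j := by
    refine exists_natCard_eq_pow_of_nsmul_eq_zero p ?_
    rintro ⟨z, hz⟩
    apply Subtype.ext
    induction z using QuotientAddGroup.induction_on with
    | H a' =>
      rw [AddMonoidHom.mem_ker, hgb, QuotientAddGroup.eq_zero_iff] at hz
      rw [AddSubgroupClass.coe_nsmul, ZeroMemClass.coe_zero]
      change p • (QuotientAddGroup.mk a' : A' ⧸ C') = 0
      rw [← QuotientAddGroup.mk_nsmul, QuotientAddGroup.eq_zero_iff, ← hfg a']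
      exact hfC _ hz
  -- (6)–(8) the counts
  have h6 := natCard_ker_eq_mul_natCard_ker_quotient f C C' hC'f fb hfb
  have h6' := natCard_ker_eq_mul_natCard_ker_quotient g C' C hCg gb hgb
  have h7 := natCard_torsionBy_inf_eq_mul p f g hgf C C' hfC hC'f
  -- (9) assemble: `#ker g · #ker f = p ^ (zpCorank A p + i + j)` with `i ≡ j (mod 2)`
  have hprod : Nat.card g.ker * Nat.card f.ker = p ^ (zpCorank A p + i + j) := by
    rw [h6, h6', hi, hj, pow_add, pow_add, h8, h7]
    ring
  rw [hi, hj, Nat.log_pow hp.one_lt, Nat.log_pow hp.one_lt] at hpar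
  rw [hprod, Nat.log_pow hp.one_lt]
  omega

end Summit.Parity.BatemanHorn.Theorems.PencilSelmerDictionary

end
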